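import Summits.ResolutionOfSingularities.ResolutionOfSingularities.Theorems.EigenLadderLU5B
import HarnessLib

/-!
[WRITER NOTE (decomp-res writer g12): imports `EigenLadderLU5B` (the 400-line split of the lens's
`EigenLadderLU5`) instead of `EigenLadderLU5`; content otherwise verbatim.]

# EigenLadderLU (6) — PART G (tame eigen-cell, headline law
`galoisHenselDescentDatum_of_stableFlag`) and PART H (located residual `R24⁺`, cut, `closes_eigen`)
-/

namespace Summit.ResolutionOfSingularities.ResolutionOfSingularities.Theorems.EigenLadderLU

open Literature.AlgebraicGeometry.Resolution
open Summit.ResolutionOfSingularities.ResolutionOfSingularities.Theorems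
open Summit.ResolutionOfSingularities.ResolutionOfSingularities.Theorems.AdaptedChartHensel
open Summit.ResolutionOfSingularities.ResolutionOfSingularities.Theorems.GaloisDescentLU
open Summit.ResolutionOfSingularities.ResolutionOfSingularities.Theorems.KeyChainLU
open Summit.ResolutionOfSingularities.ResolutionOfSingularities.Theorems.HenselKeyChainLU

/-! ## PART G — THE GENERAL TAME EIGEN-CELL and the headline law from a BARE `σ`-STABLE FLAG CHART
(all four coordinates moved by `σ`; no downstairs frame given in advance) -/

section EigenCell

variable {k : Type} [Field k] {K : Type} [Field K] [Algebra k K]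

/-- **THE TAME EIGEN-CELL below `O`** (`TameEigenChartBelow k O`; general characters): as
`TameKummerChartBelow` but the value-adapted regular chart `(A, x)` upstairs is only an EIGEN-chart for the
cyclic tame action, `σ x_j = ζ^{t_j} x_j` with `t₀ = 1` — no coordinate is required to be `σ`-fixed, so no
part of a downstairs frame is given in advance. -/
def TameEigenChartBelow (k : Type) [Field k] {K : Type} [Field K] [Algebra k K]
    (O : ValuationSubring K) : Prop :=
  ∃ K' : IntermediateField K (AlgebraicClosure K), FiniteDimensional K K' ∧ IsGalois K K' ∧
  ∃ σ : K' ≃ₐ[K] K', (∀ g : K' ≃ₐ[K] K', ∃ i : ℕ, g = σ ^ i) ∧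
  ∃ ℓ : ℕ, 0 < ℓ ∧ (ℓ : k) ≠ 0 ∧ ∃ ζ : k, IsPrimitiveRoot ζ ℓ ∧
  ∃ O' : ValuationSubring K', O'.comap (algebraMap K K') = O ∧ (∀ y : K', y ∈ O' ↔ σ y ∈ O') ∧
    (∀ y ∈ O', ∃ c : k, y - algebraMap k K' c ∈ O'.nonunits) ∧
  ∃ (A : Subalgebra k K') (hAO : A.toSubring ≤ O'.toSubring) (x : Fin 4 → K') (hx : ∀ i, x i ∈ A),
    A.FG ∧ IsFractionRing A K' ∧
    IsRegularLocalRing (Localization.AtPrime (centreIdeal A O' hAO)) ∧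
    ringKrullDim (Localization.AtPrime (centreIdeal A O' hAO)) = 4 ∧
    IsLocalRing.maximalIdeal (Localization.AtPrime (centreIdeal A O' hAO)) =
      Ideal.span (Set.range fun i =>
        algebraMap A (Localization.AtPrime (centreIdeal A O' hAO)) ⟨x i, hx i⟩) ∧
    (∀ m : Fin 3 → ℤ, (∏ i : Fin 3, O'.valuation (x (Fin.castSucc i)) ^ m i) = 1 → m = 0) ∧
    (∀ z : K', z ≠ 0 → ∃ E : ℕ, 0 < E ∧ ∃ m : Fin 3 → ℤ,
      O'.valuation z ^ E = ∏ i : Fin 3, O'.valuation (x (Fin.castSucc i)) ^ m i) ∧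
    ∃ t : Fin 4 → ℕ, t 0 = 1 ∧ ∀ j, σ (x j) = algebraMap k K' (ζ ^ t j) * x j

/-- The Kummer cell is the eigen-cell with characters `t = (1, 0, 0, 0)`. [folklore] -/
theorem tameEigenChartBelow_of_kummer (O : ValuationSubring K) (h : TameKummerChartBelow k O) :
    TameEigenChartBelow k O := by
  obtain ⟨K', hfin, hgal, σ, hcyc, ℓ, hℓ, hℓk, ζ, hζ, O', hO'O, hσO', hκ', A, hAO, x, hx, hAfg, hfrac,
    hreg, hdim, hmax, hind, hspan, hx0σ, hxfix⟩ := h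
  refine ⟨K', hfin, hgal, σ, hcyc, ℓ, hℓ, hℓk, ζ, hζ, O', hO'O, hσO', hκ', A, hAO, x, hx, hAfg, hfrac,
    hreg, hdim, hmax, hind, hspan, fun j => if j = 0 then 1 else 0, if_pos rfl, fun j => ?_⟩
  by_cases hj : j = 0
  · subst hj
    have h1 : (fun j : Fin 4 => if j = 0 then 1 else 0) 0 = 1 := if_pos rfl
    rw [h1, pow_one, hx0σ]
  · obtain ⟨i, rfl⟩ : ∃ i : Fin 3, j = i.succ := ⟨j.pred hj, (Fin.succ_pred j hj).symm⟩
    have h1 : (fun j : Fin 4 => if j = 0 then 1 else 0) i.succ = 0 := if_neg hj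
    rw [h1, pow_zero, map_one, one_mul, hxfix]

/-- **LAW ON THE EIGEN-CELL (decided modulo THEOREM D)** — PART F packaged. [folklore] -/
theorem galoisHenselDescentDatum_of_tameEigenChartBelow (hD : TheoremD k) (O : ValuationSubring K)
    (hr : Nonempty O.valuation.RankOne) (h : TameEigenChartBelow k O) :
    GaloisHenselDescentDatum k O := by
  obtain ⟨K', hfin, hgal, σ, hcyc, ℓ, hℓ, hℓk, ζ, hζ, O', hO'O, hσO', hκ', A, hAO, x, hx, hAfg, hfrac,
    hreg, hdim, hmax, hind, hspan, t, ht0, heig⟩ := h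
  haveI := hfin
  haveI := hgal
  exact galoisHenselDescentDatum_of_diagonalChart hD O hr K' σ hcyc hℓ hℓk hζ O' hO'O hσO' hκ' A hAO x
    hx hAfg hfrac hreg hdim hmax hind hspan t ht0 heig

/-- … hence the Hensel key-chain cell (g23) … [folklore] -/
theorem henselKeyChainTopBelow_of_tameEigenChartBelow (hD : TheoremD k) (O : ValuationSubring K)
    (hr : Nonempty O.valuation.RankOne) (h : TameEigenChartBelow k O) :
    HenselKeyChainTopBelow k O :=
  henselKeyChainTopBelow_of_galoisHenselDescent O
    (galoisHenselDescentDatum_of_tameEigenChartBelow hD O hr h)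

/-- … and relative LU at `O` (g22). [folklore] -/
theorem relLU_of_tameEigenChartBelow (hD : TheoremD k) (O : ValuationSubring K)
    (hr : Nonempty O.valuation.RankOne) (h : TameEigenChartBelow k O) :
    RelLocalUniformization k K O :=
  relLU_of_galoisHenselDescent (galoisHenselDescentDatum_of_tameEigenChartBelow hD O hr h)

/-- Contrapositive rung (mod D): OFF the descent cell there is NO tame eigen-chart. [folklore] -/
theorem not_tameEigenChartBelow_of_not_datum (hD : TheoremD k) (O : ValuationSubring K)
    (hr : Nonempty O.valuation.RankOne) (h : ¬ GaloisHenselDescentDatum k O) :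
    ¬ TameEigenChartBelow k O :=
  fun hc => h (galoisHenselDescentDatum_of_tameEigenChartBelow hD O hr hc)

/-- **INSTRUMENT FROM A BARE FLAG CHART (hypothesis-free in THEOREM D).**  UPSTAIRS: a finite cyclic
tame Galois `K' | K` (`⟨σ⟩`, `σ^ℓ = 1`, `(ℓ : k) ≠ 0`, `μ_ℓ ⊆ k`), a `σ`-stable residually rational
prolongation `O'`, and a value-adapted regular chart `(A, u₀, …, u₃)` with `A` `σ`-stable whose
coordinates are `σ`-stable TO FIRST ORDER ONLY: one relation per coordinate
`σ(u_j) b_j = a_j u_j`, `b_j` a unit, `a_j ≡ ζ^{t_j} b_j (mod 𝔪')`, `t₀ = 1` (every `u_j` may be MOVED by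
`σ`).  Then the isotypic projections `x_j = P_{ζ^{t_j}}(u_j)` (PART B `eigenFrame_of_stableFlag`) form
a tame eigen-chart: `TameEigenChartBelow k O`. [CossartPiltant2008, proof of Prop. 6.2] [folklore] -/
theorem tameEigenChartBelow_of_stableFlag (O : ValuationSubring K)
    (K' : IntermediateField K (AlgebraicClosure K)) [FiniteDimensional K K'] [IsGalois K K']
    (σ : K' ≃ₐ[K] K') (hcyc : ∀ g : K' ≃ₐ[K] K', ∃ i : ℕ, g = σ ^ i)
    {ℓ : ℕ} (hℓ : 0 < ℓ) (hℓk : (ℓ : k) ≠ 0) (hσℓ : σ ^ ℓ = 1) {ζ : k} (hζ : IsPrimitiveRoot ζ ℓ)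
    (O' : ValuationSubring K') (hO'O : O'.comap (algebraMap K K') = O)
    (hσO' : ∀ y : K', y ∈ O' ↔ σ y ∈ O')
    (hκ' : ∀ y ∈ O', ∃ c : k, y - algebraMap k K' c ∈ O'.nonunits)
    (A : Subalgebra k K') (hAO : A.toSubring ≤ O'.toSubring) (hAσ : ∀ a ∈ A, σ a ∈ A)
    (u : Fin 4 → K') (hu : ∀ i, u i ∈ A) (hAfg : A.FG) (hfrac : IsFractionRing A K')
    (hreg : IsRegularLocalRing (Localization.AtPrime (centreIdeal A O' hAO)))
    (hdim : ringKrullDim (Localization.AtPrime (centreIdeal A O' hAO)) = 4)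
    (hmax : IsLocalRing.maximalIdeal (Localization.AtPrime (centreIdeal A O' hAO)) =
      Ideal.span (Set.range fun i =>
        algebraMap A (Localization.AtPrime (centreIdeal A O' hAO)) ⟨u i, hu i⟩))
    (hind : ∀ m : Fin 3 → ℤ, (∏ i : Fin 3, O'.valuation (u (Fin.castSucc i)) ^ m i) = 1 → m = 0)
    (hspan : ∀ z : K', z ≠ 0 → ∃ E : ℕ, 0 < E ∧ ∃ m : Fin 3 → ℤ,
      O'.valuation z ^ E = ∏ i : Fin 3, O'.valuation (u (Fin.castSucc i)) ^ m i)
    (t : Fin 4 → ℕ) (ht0 : t 0 = 1)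
    (a₁ b₁ : Fin 4 → K') (ha₁ : ∀ j, a₁ j ∈ A) (hb₁ : ∀ j, b₁ j ∈ A)
    (hb₁1 : ∀ j, O'.valuation (b₁ j) = 1) (hstep : ∀ j, σ (u j) * b₁ j = a₁ j * u j)
    (hres₁ : ∀ j, O'.valuation (a₁ j - algebraMap k K' (ζ ^ t j) * b₁ j) < 1) :
    TameEigenChartBelow k O := by
  let σk : K' ≃ₐ[k] K' := σ.restrictScalars k
  have hσkℓ : σk ^ ℓ = 1 := by
    ext y
    rw [restrictScalars_pow_apply, hσℓ]
    rfl
  obtain ⟨x, hx, -, hσx, hxv, hmax'⟩ :=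
    eigenFrame_of_stableFlag σk hℓ hℓk hσkℓ hζ.pow_eq_one O' hσO' A hAO hAσ u hu hmax t a₁ b₁ ha₁ hb₁
      hb₁1 hstep hres₁
  have hprod : ∀ m : Fin 3 → ℤ, (∏ i : Fin 3, O'.valuation (x (Fin.castSucc i)) ^ m i) =
      ∏ i : Fin 3, O'.valuation (u (Fin.castSucc i)) ^ m i := fun m =>
    Finset.prod_congr rfl fun i _ => by rw [hxv]
  refine ⟨K', ‹_›, ‹_›, σ, hcyc, ℓ, hℓ, hℓk, ζ, hζ, O', hO'O, hσO', hκ', A, hAO, x, hx, hAfg, hfrac,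
    hreg, hdim, hmax', fun m hm => hind m (by rw [← hprod, hm]), fun z hz => ?_, t, ht0, fun j => ?_⟩
  · obtain ⟨E, hE, m, hm⟩ := hspan z hz
    exact ⟨E, hE, m, by rw [hprod, hm]⟩
  · change σk (x j) = _
    exact hσx j

/-- **(K-e″) FROM A BARE `σ`-STABLE FLAG CHART — the headline law of this node in its strongest form
(decided modulo THEOREM D).**  UPSTAIRS exactly as in `tameEigenChartBelow_of_stableFlag` (no `σ`-fixed
coordinate, no downstairs frame, chart not defined over `K`); DOWNSTAIRS: `GaloisHenselDescentDatum k O`,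
with eigen-frame `x = P(u)` (PART B), sub-top `F₁ = k(x₀^ℓ, x_j x₀^{(ℓ-1)t_j})` the field of invariant
monomials (PART C), key-chain by THEOREM D, `K' = F₁(x₀)(η')` (PART F).
[CossartPiltant2008, Prop. 6.2, Thm. 6.5] [Grothendieck1967, Prop. 18.4.6 (ii)] [folklore] -/
theorem galoisHenselDescentDatum_of_stableFlag (hD : TheoremD k) (O : ValuationSubring K)
    (hr : Nonempty O.valuation.RankOne)
    (K' : IntermediateField K (AlgebraicClosure K)) [FiniteDimensional K K'] [IsGalois K K']
    (σ : K' ≃ₐ[K] K') (hcyc : ∀ g : K' ≃ₐ[K] K', ∃ i : ℕ, g = σ ^ i)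
    {ℓ : ℕ} (hℓ : 0 < ℓ) (hℓk : (ℓ : k) ≠ 0) (hσℓ : σ ^ ℓ = 1) {ζ : k} (hζ : IsPrimitiveRoot ζ ℓ)
    (O' : ValuationSubring K') (hO'O : O'.comap (algebraMap K K') = O)
    (hσO' : ∀ y : K', y ∈ O' ↔ σ y ∈ O')
    (hκ' : ∀ y ∈ O', ∃ c : k, y - algebraMap k K' c ∈ O'.nonunits)
    (A : Subalgebra k K') (hAO : A.toSubring ≤ O'.toSubring) (hAσ : ∀ a ∈ A, σ a ∈ A)
    (u : Fin 4 → K') (hu : ∀ i, u i ∈ A) (hAfg : A.FG) (hfrac : IsFractionRing A K')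
    (hreg : IsRegularLocalRing (Localization.AtPrime (centreIdeal A O' hAO)))
    (hdim : ringKrullDim (Localization.AtPrime (centreIdeal A O' hAO)) = 4)
    (hmax : IsLocalRing.maximalIdeal (Localization.AtPrime (centreIdeal A O' hAO)) =
      Ideal.span (Set.range fun i =>
        algebraMap A (Localization.AtPrime (centreIdeal A O' hAO)) ⟨u i, hu i⟩))
    (hind : ∀ m : Fin 3 → ℤ, (∏ i : Fin 3, O'.valuation (u (Fin.castSucc i)) ^ m i) = 1 → m = 0)
    (hspan : ∀ z : K', z ≠ 0 → ∃ E : ℕ, 0 < E ∧ ∃ m : Fin 3 → ℤ,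
      O'.valuation z ^ E = ∏ i : Fin 3, O'.valuation (u (Fin.castSucc i)) ^ m i)
    (t : Fin 4 → ℕ) (ht0 : t 0 = 1)
    (a₁ b₁ : Fin 4 → K') (ha₁ : ∀ j, a₁ j ∈ A) (hb₁ : ∀ j, b₁ j ∈ A)
    (hb₁1 : ∀ j, O'.valuation (b₁ j) = 1) (hstep : ∀ j, σ (u j) * b₁ j = a₁ j * u j)
    (hres₁ : ∀ j, O'.valuation (a₁ j - algebraMap k K' (ζ ^ t j) * b₁ j) < 1) :
    GaloisHenselDescentDatum k O :=
  galoisHenselDescentDatum_of_tameEigenChartBelow hD O hr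
    (tameEigenChartBelow_of_stableFlag O K' σ hcyc hℓ hℓk hσℓ hζ O' hO'O hσO' hκ' A hAO hAσ u hu hAfg
      hfrac hreg hdim hmax hind hspan t ht0 a₁ b₁ ha₁ hb₁ hb₁1 hstep hres₁)

/-- … and hence relative LU at `O` (mod D), from the bare flag chart upstairs. [folklore] -/
theorem relLU_of_stableFlag (hD : TheoremD k) (O : ValuationSubring K)
    (hr : Nonempty O.valuation.RankOne)
    (K' : IntermediateField K (AlgebraicClosure K)) [FiniteDimensional K K'] [IsGalois K K']
    (σ : K' ≃ₐ[K] K') (hcyc : ∀ g : K' ≃ₐ[K] K', ∃ i : ℕ, g = σ ^ i)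
    {ℓ : ℕ} (hℓ : 0 < ℓ) (hℓk : (ℓ : k) ≠ 0) (hσℓ : σ ^ ℓ = 1) {ζ : k} (hζ : IsPrimitiveRoot ζ ℓ)
    (O' : ValuationSubring K') (hO'O : O'.comap (algebraMap K K') = O)
    (hσO' : ∀ y : K', y ∈ O' ↔ σ y ∈ O')
    (hκ' : ∀ y ∈ O', ∃ c : k, y - algebraMap k K' c ∈ O'.nonunits)
    (A : Subalgebra k K') (hAO : A.toSubring ≤ O'.toSubring) (hAσ : ∀ a ∈ A, σ a ∈ A)
    (u : Fin 4 → K') (hu : ∀ i, u i ∈ A) (hAfg : A.FG) (hfrac : IsFractionRing A K')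
    (hreg : IsRegularLocalRing (Localization.AtPrime (centreIdeal A O' hAO)))
    (hdim : ringKrullDim (Localization.AtPrime (centreIdeal A O' hAO)) = 4)
    (hmax : IsLocalRing.maximalIdeal (Localization.AtPrime (centreIdeal A O' hAO)) =
      Ideal.span (Set.range fun i =>
        algebraMap A (Localization.AtPrime (centreIdeal A O' hAO)) ⟨u i, hu i⟩))
    (hind : ∀ m : Fin 3 → ℤ, (∏ i : Fin 3, O'.valuation (u (Fin.castSucc i)) ^ m i) = 1 → m = 0)
    (hspan : ∀ z : K', z ≠ 0 → ∃ E : ℕ, 0 < E ∧ ∃ m : Fin 3 → ℤ,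
      O'.valuation z ^ E = ∏ i : Fin 3, O'.valuation (u (Fin.castSucc i)) ^ m i)
    (t : Fin 4 → ℕ) (ht0 : t 0 = 1)
    (a₁ b₁ : Fin 4 → K') (ha₁ : ∀ j, a₁ j ∈ A) (hb₁ : ∀ j, b₁ j ∈ A)
    (hb₁1 : ∀ j, O'.valuation (b₁ j) = 1) (hstep : ∀ j, σ (u j) * b₁ j = a₁ j * u j)
    (hres₁ : ∀ j, O'.valuation (a₁ j - algebraMap k K' (ζ ^ t j) * b₁ j) < 1) :
    RelLocalUniformization k K O :=
  relLU_of_galoisHenselDescent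
    (galoisHenselDescentDatum_of_stableFlag hD O hr K' σ hcyc hℓ hℓk hσℓ hζ O' hO'O hσO' hκ' A hAO hAσ
      u hu hAfg hfrac hreg hdim hmax hind hspan t ht0 a₁ b₁ ha₁ hb₁ hb₁1 hstep hres₁)

end EigenCell

end Summit.ResolutionOfSingularities.ResolutionOfSingularities.Theorems.EigenLadderLU

namespace Summit.ResolutionOfSingularities.ResolutionOfSingularities.Theorems.EigenLadderLU

open Polynomial
open Literature.AlgebraicGeometry.Resolution
open Summit.ResolutionOfSingularities.ResolutionOfSingularities.Theses
open Summit.ResolutionOfSingularities.ResolutionOfSingularities.Theorems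
open Summit.ResolutionOfSingularities.ResolutionOfSingularities.Theorems.AdaptedChartHensel
open Summit.ResolutionOfSingularities.ResolutionOfSingularities.Theorems.GaloisDescentLU
open Summit.ResolutionOfSingularities.ResolutionOfSingularities.Theorems.KeyChainLU
open Summit.ResolutionOfSingularities.ResolutionOfSingularities.Theorems.HenselKeyChainLU
open Summit.ResolutionOfSingularities.ResolutionOfSingularities.Theorems.PfaffLine
open Summit.ResolutionOfSingularities.ResolutionOfSingularities.Theorems.ToricLadder
open Summit.ResolutionOfSingularities.ResolutionOfSingularities.Theorems.KaplanskyLadder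
open Summit.ResolutionOfSingularities.ResolutionOfSingularities.Theorems.PerronLadder
open Summit.ResolutionOfSingularities.ResolutionOfSingularities.Theorems.DefectlessLadder
open Summit.ResolutionOfSingularities.ResolutionOfSingularities.Theorems.WCut


/-! ## PART H — the located residual one rung further: OFF THE EIGEN-CELL (`R24⁺`), its cut (mod D) and
ROOT BY NAME `closes_eigen` -/

section EigenCut

/-- **THE EIGEN-CELL PIECE** of the g23 residual: places carrying a tame eigen-chart. -/
def NonKHToricArchLUKeyHenselDescentEigenCell (e c n : ℕ) : Prop :=
  ∀ p : ℕ, p.Prime → ∀ (k K : Type) [Field k] [CharP k p] [Field K] [Algebra k K],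
    Algebra.trdeg k K ≤ n → ∀ O : ValuationSubring K, Nonempty O.valuation.RankOne →
    (∀ y ∈ O, ∃ f : Polynomial k, f ≠ 0 ∧ Polynomial.aeval y f ∈ O.nonunits) →
    ¬ IsAbhyankarPlace O (algebraMap k K).fieldRange ⊤ →
    ¬ (∃ d : ℕ, d < n ∧ SepDenseBelow k O d) → ¬ ToricDenseBelow k O e → ¬ KHTopBelow k O c →
    ¬ KeyChainTopBelow k O → ¬ HenselKeyChainTopBelow k O → ¬ GaloisHenselDescentDatum k O →
    TameEigenChartBelow k O → RelLocalUniformization k K O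

/-- THE LAW DECIDES THE EIGEN-CELL PIECE modulo THEOREM D, for all parameters. [folklore] -/
theorem nonKHToricArchLUKeyHenselDescentEigenCell_of_theoremD (hD : TheoremDAll) (e c n : ℕ) :
    NonKHToricArchLUKeyHenselDescentEigenCell e c n :=
  fun _ _ k _ _ _ _ _ _ O hr _ _ _ _ _ _ _ _ hC => relLU_of_tameEigenChartBelow (hD k) O hr hC

/-- **LOCATED RESIDUAL `R24⁺`** (tag UNDECIDED · WEAKER than the root and than `R24` · located at
`(3, 3, 4)`): the g23 residual OFF the tame EIGEN-cell — places over which NO tame cyclic cover acquires an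
eigen-adapted regular chart (any characters). -/
def NonKHToricArchLUKeyHenselDescentEigen (e c n : ℕ) : Prop :=
  ∀ p : ℕ, p.Prime → ∀ (k K : Type) [Field k] [CharP k p] [Field K] [Algebra k K],
    Algebra.trdeg k K ≤ n → ∀ O : ValuationSubring K, Nonempty O.valuation.RankOne →
    (∀ y ∈ O, ∃ f : Polynomial k, f ≠ 0 ∧ Polynomial.aeval y f ∈ O.nonunits) →
    ¬ IsAbhyankarPlace O (algebraMap k K).fieldRange ⊤ →
    ¬ (∃ d : ℕ, d < n ∧ SepDenseBelow k O d) → ¬ ToricDenseBelow k O e → ¬ KHTopBelow k O c →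
    ¬ KeyChainTopBelow k O → ¬ HenselKeyChainTopBelow k O → ¬ GaloisHenselDescentDatum k O →
    ¬ TameEigenChartBelow k O → RelLocalUniformization k K O

/-- `R24 ⇒ R24⁺` (hypothesis-free): off the eigen-cell one is off its Kummer face. [folklore] -/
theorem nonKHToricArchLUKeyHenselDescentEigen_of_kummer {e c n : ℕ}
    (h : NonKHToricArchLUKeyHenselDescentKummer e c n) : NonKHToricArchLUKeyHenselDescentEigen e c n :=
  fun p hp k K _ _ _ _ hd O h1 h0 hA hnd hnt hnk hkey hH hδ hE =>
    h p hp k K hd O h1 h0 hA hnd hnt hnk hkey hH hδ fun hK => hE (tameEigenChartBelow_of_kummer O hK)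

/-- `R23 ⇒ R24⁺` (hypothesis-free). [folklore] -/
theorem nonKHToricArchLUKeyHenselDescentEigen_of_descent {e c n : ℕ}
    (h : NonKHToricArchLUKeyHenselDescent e c n) : NonKHToricArchLUKeyHenselDescentEigen e c n :=
  nonKHToricArchLUKeyHenselDescentEigen_of_kummer (nonKHToricArchLUKeyHenselDescentKummer_of_descent h)

/-- **THE EIGEN CUT** (kernel, exact modulo THEOREM D). [folklore] -/
theorem nonKHToricArchLUKeyHenselDescent_iff_eigen (hD : TheoremDAll) {e c n : ℕ} :
    NonKHToricArchLUKeyHenselDescent e c n ↔ NonKHToricArchLUKeyHenselDescentEigen e c n := by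
  refine ⟨nonKHToricArchLUKeyHenselDescentEigen_of_descent,
    fun h p hp k K _ _ _ _ hd O hr hz hA hnd hnt hnk hkey hH hδ => ?_⟩
  exact h p hp k K hd O hr hz hA hnd hnt hnk hkey hH hδ
    (not_tameEigenChartBelow_of_not_datum (hD k) O hr hδ)

/-- The two located residuals of this node agree modulo THEOREM D. [folklore] -/
theorem nonKHToricArchLUKeyHenselDescentKummer_iff_eigen (hD : TheoremDAll) {e c n : ℕ} :
    NonKHToricArchLUKeyHenselDescentKummer e c n ↔ NonKHToricArchLUKeyHenselDescentEigen e c n :=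
  (nonKHToricArchLUKeyHenselDescent_iff_kummer hD).symm.trans (nonKHToricArchLUKeyHenselDescent_iff_eigen hD)

/-- The same cut as a conjunction «eigen-cell piece ∧ R24⁺» (mod D). [folklore] -/
theorem nonKHToricArchLUKeyHenselDescent_iff_cell_and_eigen (hD : TheoremDAll) {e c n : ℕ} :
    NonKHToricArchLUKeyHenselDescent e c n ↔
      NonKHToricArchLUKeyHenselDescentEigenCell e c n ∧ NonKHToricArchLUKeyHenselDescentEigen e c n :=
  ⟨fun h => ⟨nonKHToricArchLUKeyHenselDescentEigenCell_of_theoremD hD e c n,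
      nonKHToricArchLUKeyHenselDescentEigen_of_descent h⟩,
    fun h => (nonKHToricArchLUKeyHenselDescent_iff_eigen hD).2 h.2⟩

/-- The EXACT re-location at `(3, 3, 4)`. [folklore] -/
theorem nonKHToricArchLUKeyHenselDescent334_iff_eigen (hD : TheoremDAll) :
    NonKHToricArchLUKeyHenselDescent 3 3 4 ↔ NonKHToricArchLUKeyHenselDescentEigen 3 3 4 :=
  nonKHToricArchLUKeyHenselDescent_iff_eigen hD

/-- The g17/g20 residual family re-located (mod D). [folklore] -/
theorem nonKHToricArchLU_iff_eigen (hD : TheoremDAll) {e c n : ℕ} :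
    NonKHToricArchLU e c n ↔ NonKHToricArchLUKeyHenselDescentEigen e c n :=
  nonKHToricArchLU_iff_descent.trans (nonKHToricArchLUKeyHenselDescent_iff_eigen hD)

/-- `R24⁺` follows from the root outright (hypothesis-free). [folklore] -/
theorem nonKHToricArchLUKeyHenselDescentEigen_of_root (hS : _root_.ResolutionOfSingularities)
    (e c n : ℕ) : NonKHToricArchLUKeyHenselDescentEigen e c n :=
  nonKHToricArchLUKeyHenselDescentEigen_of_descent (nonKHToricArchLUKeyHenselDescent_of_root hS e c n)

/-- **`closes_eigen` — ROOT BY NAME** from floor + CJS + Π₁ + THEOREM D + `R24⁺` (`d ≥ 4`) + 0642.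
[folklore] -/
theorem closes_eigen (hCP : CossartPiltant2019LU3.{0}) (hCJS : CossartJannsenSaito2020Embedded.{0})
    (hAsc : KK05NCVAscent) (hD : TheoremDAll)
    (hN : ∀ d, 4 ≤ d → NonKHToricArchLUKeyHenselDescentEigen 3 3 d)
    (h₃ : Valuative.PatchingRel) : _root_.ResolutionOfSingularities :=
  closes_descent hCP hCJS hAsc
    (fun d hd => (nonKHToricArchLUKeyHenselDescent_iff_eigen hD).2 (hN d hd)) h₃

/-- Root-level summary for `R24⁺`. [folklore] -/
theorem root_iff_eigen_sigma (hCP : CossartPiltant2019LU3.{0})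
    (hCJS : CossartJannsenSaito2020Embedded.{0}) (hAsc : KK05NCVAscent) (hD : TheoremDAll)
    (h₃ : Valuative.PatchingRel) :
    _root_.ResolutionOfSingularities ↔ ∀ d, 4 ≤ d → NonKHToricArchLUKeyHenselDescentEigen 3 3 d := by
  rw [root_iff_descent_sigma hCP hCJS hAsc h₃]
  exact forall₂_congr fun d _ => nonKHToricArchLUKeyHenselDescent_iff_eigen hD

end EigenCut

end Summit.ResolutionOfSingularities.ResolutionOfSingularities.Theorems.EigenLadderLU
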